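import Literature.Probability.LatticeModels.DiagonalCylinderDeterminant
import Literature.Probability.LatticeModels.DiagonalTorusSandwich
import Literature.Probability.LatticeModels.PlanarIsingWuCauchy
import Literature.Probability.LatticeModels.PlanarIsingCriticalMagnetization
import Literature.Probability.LatticeModels.CriticalTwoPointLower
import HarnessLib

/-!
# Wu's critical diagonal correlations of the planar Ising model and the discharge of `wu_rhoCHI`

Topic `Probability/LatticeModels`, namespace `Literature.Probability.LatticeModels`. The assembly of
the exact computation of the critical DIAGONAL correlations of the nearest-neighbour Ising model on
`ℤ²` (T. T. Wu, Phys. Rev. **149** (1966) 380; B. M. McCoy, T. T. Wu, *The two-dimensional Ising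
model* (1973), Ch. XI):

  **`⟨σ_{(0,0)} σ_{(n,n)}⟩⁺_{β_c} = wuDiag n = (2/π)^n ∏_{l=1}^{n-1} (1 - 1/(4l²))^{l-n}`**,  `n ≥ 1`

(`twoPointPlus_criticalBetaTwo_diag_eq_wuDiag`), along the route "diagonal transfer matrix ↔
critical transverse-field Ising chain" (M. Suzuki, Prog. Theor. Phys. 46 (1971) 1337; P. Pfeuty, Ann.
Phys. 57 (1970) 79), all of whose steps are theorems of the tree:

1. `DiagonalTransferMatrix` — the diagonal transfer kernel `K` and `T₂ = KᵀK` commute with the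
   chain `H = -∑σᶻσᶻ - h∑σˣ` at `h = (sinh 2β)⁻²`, `= 1` at `β_c`;
2. `TransverseIsingFermions`, `DiagonalTransferVacuum` — the Perron vector `ψ_N` of `T₂` is the
   Fock vacuum of the critical chain's lowering modes (LSM/Pfeuty fermions; diamagnetic inequality);
3. `DiagonalCylinderDeterminant` — `∑ r₀r_n ψ_N² / ∑ ψ_N² = det (1/(N sin(π(2(j-i)+1)/(2N))))_{i,j<n}
   → det (2/(π(2(j-i)+1)))_{i,j<n}` as `N → ∞` (Wick);
4. `PlanarIsingWuCauchy` — that Cauchy determinant is `wuDiag n`;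
5. `DiagonalTorus`, `DiagonalTorusSandwich` — on the diagonally wrapped tori `ℤ²/⟨(2NM',0),(-N,N)⟩`
   the pair function between the images of `0` and `x_n = (-n, n)` tends, as `M' → ∞`, to the
   ground-state ratio of 3., and where `⟨σ_0σ_{x_n}⟩^∅ = ⟨σ_0σ_{x_n}⟩⁺` these cylinder values tend
   to `⟨σ_0σ_{x_n}⟩⁺` (Griffiths sandwich, BGJS 1973);
6. at `β_c(2)`, free = plus by `m*(β_c) = 0` (`PlanarIsingCriticalMagnetization`, Yang 1952 /
   Onsager's formula, proved in the tree) and the Lebowitz–Martin-Löf criterion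
   (`PlusFreeComparison`); finally `⟨σ_0σ_{(-n,n)}⟩⁺ = ⟨σ_0σ_{(n,n)}⟩⁺` by reflection symmetry.

Consequently the named fact `wu_rhoCHI` of `PlanarIsingOnePoint` (Chelkak–Hongler–Izyurov, Ann.
Math. 181 (2015), Remark 1.2 (iii): `ϱ(δ) ∼ 𝒞₂ δ^{1/4}`) holds: **`wu_rhoCHI_holds`**, through
`PlanarIsingWuDiag.wu_rhoCHI_of_twoPointPlus_diag_eq` (the asymptotics `N^{1/4} wuDiag N → A_Wu > 0`,
proved there) — the discharge of the fact, with net debt `-1` and no new named fact.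

## References

* T. T. Wu, Phys. Rev. 149 (1966) 380–401; B. M. McCoy, T. T. Wu, *The two-dimensional Ising
  model*, Harvard Univ. Press (1973), Ch. XI.
* M. Suzuki, Prog. Theor. Phys. 46 (1971) 1337–1359; P. Pfeuty, Ann. Phys. 57 (1970) 79–90.
* D. Chelkak, C. Hongler, K. Izyurov, Ann. of Math. 181 (2015) 1087–1138, Remark 1.2 (iii).
* G. Benettin, G. Gallavotti, G. Jona-Lasinio, A. L. Stella, Comm. Math. Phys. 30 (1973) 45–54, §3.
-/

noncomputable section

open Filter Topology Matrix Literature.LinearAlgebra.Matrix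

namespace Literature.Probability.LatticeModels

/-- **At `β_c(2)` the free and plus two-point functions of `ℤ²` agree** (everywhere; by
`m*(β_c(2)) = 0` and the Lebowitz–Martin-Löf criterion). [cite: BenettinGallavottiJonaLasinioStella1973, §3, eq. (3.1) (at β = β_c via c)–d))] -/
theorem twoPointFree_criticalBetaTwo_eq_twoPointPlus {x : Site 2} (hx : x ≠ 0) :
    twoPointFree 2 criticalBetaTwo x = twoPointPlus 2 criticalBetaTwo x := by
  rw [twoPointFree_eq_freeCorr _ hx, twoPointPlus_eq_plusCorr _ hx]
  exact freeCorr_eq_plusCorr_of_spontaneousMagnetization_eq_zero criticalBetaTwo_pos.le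
    spontaneousMagnetization_two_criticalBetaTwo_holds {0, x}

/-- The limit kernel of `DiagonalCylinderDeterminant` is the critical diagonal kernel of
`PlanarIsingWuCauchy` (same entries). [folklore] -/
theorem critDiagMatrix_eq_of (n : ℕ) :
    critDiagMatrix n = Matrix.of fun i j : Fin n => 2 / (Real.pi * (2 * ((j : ℕ) - (i : ℕ) : ℝ) + 1)) := rfl

/-- **The critical diagonal cylinder values converge to Wu's product**: for `n ≥ 1` and `N ≥ n + 3`
let `c_N = det (1/(N sin(π(2(j-i)+1)/(2N))))_{i,j<n}`; then (i) along every diagonally wrapped torus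
`ℤ²/⟨(2NM',0),(-N,N)⟩` the critical pair function between the images of `0` and `(-n, n)` tends to
`c_N` as `M' → ∞`, and (ii) `c_N → wuDiag n` as `N → ∞`. [cite: MccoyWu1973, Ch. XI (the diagonal correlation ⟨σ_{0,0}σ_{N,N}⟩ at T = T_c)] -/
theorem tendsto_diagTorusPair_criticalBetaTwo {n N : ℕ} (hN : n + 3 ≤ N) :
    Tendsto (fun M' : ℕ => diagTorusPair criticalBetaTwo N (2 * (N * M')) n) atTop (𝓝 ((diagCylReal N n).det)) := by
  haveI : NeZero N := ⟨by omega⟩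
  obtain ⟨Ω, hΩ, hAΩ, -⟩ := exists_diagPerron_polarizedVacuum (N := N)
  have hΩ0 : Ω ≠ 0 := fun h => (hΩ (fun _ => 1)).ne' (by rw [h]; rfl)
  have h1 := tendsto_diagTorusPair (β := criticalBetaTwo) (by omega : 3 ≤ N) n hΩ0 hAΩ
  rwa [diagPerron_pair_eq_real_det hΩ hAΩ (by omega : n < N)] at h1

/-- **Wu's formula for the critical diagonal correlations at the anti-diagonal point**:
`⟨σ_0 σ_{(-n,n)}⟩⁺_{β_c} = wuDiag n` for `n ≥ 1`. [cite: MccoyWu1973, Ch. XI (the diagonal correlation ⟨σ_{0,0}σ_{N,N}⟩ at T = T_c)] -/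
theorem twoPointPlus_criticalBetaTwo_antiDiag_eq_wuDiag {n : ℕ} (hn : 1 ≤ n) :
    twoPointPlus 2 criticalBetaTwo (antiDiag n) = wuDiag n := by
  have hx0 : antiDiag n ≠ 0 := antiDiag_ne_zero (by omega)
  -- the cylinder values and their two limits
  have hin : ∀ N : ℕ, n + 3 ≤ N →
      Tendsto (fun M' : ℕ => diagTorusPair criticalBetaTwo N (2 * (N * M')) n) atTop (𝓝 ((diagCylReal N n).det)) :=
    fun N hN => tendsto_diagTorusPair_criticalBetaTwo hN
  have hplus := tendsto_cyl_of_twoPointFree_eq_twoPointPlus (c := fun N => (diagCylReal N n).det)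
    criticalBetaTwo_pos.le hn hin (twoPointFree_criticalBetaTwo_eq_twoPointPlus hx0)
  have hwu : Tendsto (fun N : ℕ => (diagCylReal N n).det) atTop (𝓝 (wuDiag n)) := by
    rw [← det_critDiagMatrix n, critDiagMatrix_eq_of]
    exact tendsto_det_diagCylReal n
  exact tendsto_nhds_unique hplus hwu

/-- **Wu's critical diagonal correlations** (T. T. Wu 1966; McCoy–Wu 1973, Ch. XI): for `n ≥ 1`,
`⟨σ_{(0,0)} σ_{(n,n)}⟩⁺_{β_c(2)} = wuDiag n = (2/π)^n ∏_{l=1}^{n-1} (1 - 1/(4l²))^{l-n}`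
(`= 2/π, 16/(3π²), …`). [cite: MccoyWu1973, Ch. XI (the diagonal correlation ⟨σ_{0,0}σ_{N,N}⟩ at T = T_c)] -/
theorem twoPointPlus_criticalBetaTwo_diag_eq_wuDiag {n : ℕ} (hn : 1 ≤ n) :
    twoPointPlus 2 criticalBetaTwo ![(n : ℤ), (n : ℤ)] = wuDiag n := by
  rw [← twoPointPlus_criticalBetaTwo_antiDiag_eq_wuDiag hn]
  -- `(-n, n)` is the reflection `x₀ ↦ -x₀` of `(n, n)`
  have h : antiDiag n = Function.update (![(n : ℤ), (n : ℤ)] : Site 2) 0 (-(![(n : ℤ), (n : ℤ)] : Site 2) 0) := by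
    funext i
    fin_cases i <;> simp [antiDiag]
  rw [h, twoPointPlus_reflection_invariant_holds criticalBetaTwo_pos.le]

/-- **Discharge of the named fact `wu_rhoCHI`** (Chelkak–Hongler–Izyurov 2015, Remark 1.2 (iii):
`ϱ(δ) = ⟨σ_{(0,0)}σ_{(N,N)}⟩⁺_{β_c}`, `N = round(√2/(2δ))`, satisfies `ϱ(δ) ∼ 𝒞₂ δ^{1/4}` for some
`𝒞₂ > 0` — "[McCoy–Wu]; we do not need this result"): from Wu's exact diagonal correlations
(`twoPointPlus_criticalBetaTwo_diag_eq_wuDiag`) and the asymptotics `N^{1/4} wuDiag N → A_Wu > 0`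
(`PlanarIsingWuDiag.wu_rhoCHI_of_twoPointPlus_diag_eq`). [cite: ChelkakHonglerIzyurovAnnals2015, Remark 1.2 (iii)] -/
theorem wu_rhoCHI_holds : wu_rhoCHI :=
  wu_rhoCHI_of_twoPointPlus_diag_eq fun _ hN => twoPointPlus_criticalBetaTwo_diag_eq_wuDiag hN

end Literature.Probability.LatticeModels
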